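import Mathlib
import HarnessLib
import Summits.Ventures.LatticeQCDFlow.Exactness.SUNJitteredHMCAtomless
import Summits.Ventures.LatticeQCDFlow.Exactness.UniformJitterLaw

/-!
# `tau_jitter` AS RUN: the engine's uniform trajectory-length law `τ(1 + j(2u − 1))`, `u ∼ U(0,1)` — exact for every `(τ, j)`; converges from every start with certificates whenever `τ(1 − j) < τ₀`, in particular for `j = 1` at EVERY `τ`

HONEST FRAMING: exact (Metropolis-corrected) sampling algorithms for lattice gauge theory;
figures of merit are autocorrelation/cost numbers at stated couplings and volumes; no
continuum-physics claim.

Venture `LatticeQCDFlow` (cell pub-lqcd), topic `Exactness`, FANOUT row 9 (eng-latcore, GEN-24).  The engine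
(`latflow.core.hmc.HMC.trajectory`, 0.2.1+, row 37 RC-3): `tau_t = tau * (1 + tau_jitter * (2*rng.random() − 1))`,
drawn BEFORE and independently of the state, `nstep` fixed.  NEW WORK of the cell over GEN-24's
`SUNJitteredHMCAtomless.lean` (certificates / convergence for `wilsonJitterHMCL N d L β nstep η` whenever the Borel
law `η` of the length charges a short interval), `SUNJitteredHMCMeasurableLabels.lean` (`wilsonJitterHMCL`, exact
for every `η`) and `UniformJitterLaw.lean` (the code's law `uniformJitterLaw τ j`, `uniformJitterLaw_charges_short`).  Nothing is cited as a fact; no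
number is claimed.

## Content

* (§1 = `UniformJitterLaw.lean`: **`uniformJitterLaw τ j`** `:= (volume|_{[0,1]}).map (u ↦ τ(1 + j(2u − 1)))` — THE
  CODE'S FORMULA; a probability law; `j = 0` is the point mass at `τ`; **`uniformJitterLaw_charges_short`** — if `τ > 0`,
  `0 < j ≤ 1` and `τ(1 − j) < τ₀` then `η[τ₁, τ₂] ≠ 0` for some `0 < τ₁ ≤ τ₂ ≤ τ₀`.)
* §2 **`wilson_uniformJitterHMC_invariant`** — the engine's jittered HMC AS RUN leaves `wilsonMeasure (β/N)` invariant
  for EVERY `nstep`, `τ`, `j`; **`wilson_uniformJitterHMC_exactStep_certificate`** — there is `τ₀ > 0` (`N, d, L, β`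
  only) such that for every `nstep ≥ 1`, `τ > 0`, `0 < j ≤ 1` with `τ(1 − j) < τ₀` and EVERY Wilson-invariant Markov
  `P`: `P ∘ₖ K` is Wilson-invariant and `ε' • wilsonMeasure ≤ (P ∘ₖ K)^m(U, ·)` for every `U`;
  **`wilson_uniformJitterHMC_certificate`** (alone), **`wilson_uniformJitterHMC_orSweep_certificate`** (+ ANY schedule of
  Cabibbo–Marinari OR hits, `L ≥ 2` — `composite_sweep(f, β, 'hmc', n_or)` with `tau_jitter`);
  **`wilson_uniformJitterHMC_exactStep_uniformlyErgodic`**, **`wilson_uniformJitterHMC_orSweep_uniformlyErgodic`** —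
  geometric convergence in total variation from EVERY start, uniqueness of the invariant law.
* §3 **`wilson_fullJitterHMC_orSweep_uniformlyErgodic`** — `j = 1`: for EVERY production length `τ > 0` and every
  `nstep ≥ 1` the engine's `'hmc'(tau_jitter = 1) + n_or × 'or'` converges to the Wilson measure from every start.

NOT CLAIMED: anything for `τ(1 − j) ≥ τ₀` (every drawn trajectory long); any value of `τ₀` or of the constants (they
carry the factor `η[τ₁, τ₂]`, i.e. roughly the fraction of drawn lengths below `τ₀` — honest and possibly tiny); that
jitter improves any autocorrelation; OMF words; floating point (the code's `u` is a 53-bit uniform — GEN-22's atom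
theorems cover that reading; this file is the exact-arithmetic reading).
-/

noncomputable section

namespace Summit.Ventures.LatticeQCDFlow.Exactness

open MeasureTheory ProbabilityTheory ProbabilityTheory.Kernel Set Metric Function Filter Topology
open Literature.MathematicalPhysics.QuantumFieldTheory
open Literature.MathematicalPhysics.QuantumLattice (fundamentalRep continuous_fundamentalRep)
open scoped ENNReal Matrix Matrix.Norms.Operator NNReal

set_option backward.isDefEq.respectTransparency false

/-! ## §2 The engine's jittered HMC as run: exact always; certificates and convergence when `τ(1 − j) < τ₀` -/

section Engine

variable {N d L : ℕ} [NeZero N] [NeZero L] (β : ℝ)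

omit [NeZero N] in
/-- **EXACT FOR EVERY `(nstep, τ, j)`**: the engine's jittered HMC as run leaves `wilsonMeasure (β/N)` invariant. -/
theorem wilson_uniformJitterHMC_invariant (nstep : ℕ) (τ j : ℝ) :
    Invariant (wilsonJitterHMCL N d L β nstep (uniformJitterLaw τ j))
      (wilsonMeasure (d := d) (L := L) (fundamentalRep (Fin N)) (β / N)) :=
  wilsonJitterHMCL_invariant β nstep _

/-- **THE DOEBLIN CERTIFICATE OF THE ENGINE'S JITTERED HMC AS RUN FOLLOWED BY ANY EXACT STEP.**  There is `τ₀ > 0`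
(on `N, d, L, β` only; not computed) such that for every `nstep ≥ 1`, every production length `τ > 0` and every
jitter `0 < j ≤ 1` with `τ(1 − j) < τ₀`, and EVERY Markov kernel `P` leaving `wilsonMeasure (β/N)` invariant:
`P ∘ₖ K` leaves it invariant and `ε' • wilsonMeasure (β/N) ≤ (P ∘ₖ K)^m(U, ·)` for EVERY `U` (`m > 0`, `0 < ε' ≤ 1`). -/
theorem wilson_uniformJitterHMC_exactStep_certificate :
    ∃ τ₀ : ℝ, 0 < τ₀ ∧ ∀ (nstep : ℕ) (τ j : ℝ), 1 ≤ nstep → 0 < τ → 0 < j → j ≤ 1 → τ * (1 - j) < τ₀ →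
      ∀ (P : Kernel (GaugeConfig d L (Matrix.specialUnitaryGroup (Fin N) ℂ))
          (GaugeConfig d L (Matrix.specialUnitaryGroup (Fin N) ℂ))) [IsMarkovKernel P],
        Invariant P (wilsonMeasure (d := d) (L := L) (fundamentalRep (Fin N)) (β / N)) →
      Invariant (P ∘ₖ wilsonJitterHMCL N d L β nstep (uniformJitterLaw τ j))
          (wilsonMeasure (d := d) (L := L) (fundamentalRep (Fin N)) (β / N)) ∧
      ∃ m : ℕ, ∃ ε' : ℝ≥0∞, 0 < m ∧ 0 < ε' ∧ ε' ≤ 1 ∧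
        ∀ U : GaugeConfig d L (Matrix.specialUnitaryGroup (Fin N) ℂ),
          ε' • wilsonMeasure (d := d) (L := L) (fundamentalRep (Fin N)) (β / N) ≤
            nHit (P ∘ₖ wilsonJitterHMCL N d L β nstep (uniformJitterLaw τ j)) m U := by
  obtain ⟨τ₀, hτ₀, h⟩ := wilsonJitterHMCL_exactStep_certificate (N := N) (d := d) (L := L) β
  refine ⟨τ₀, hτ₀, fun nstep τ j hn hτ hj hj1 hshort P _ hP => ?_⟩
  obtain ⟨τ₁, τ₂, hτ₁, h12, hτ₂, hη⟩ := uniformJitterLaw_charges_short hτ hj hj1 hshort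
  exact h nstep τ₁ τ₂ (uniformJitterLaw τ j) hn hτ₁ h12 hτ₂ hη P hP

/-- **THE DOEBLIN CERTIFICATE OF THE ENGINE'S JITTERED HMC AS RUN, ALONE**: same `τ₀`; `ε' • wilsonMeasure (β/N) ≤
K^m(U, ·)` for every `U` whenever `τ(1 − j) < τ₀` (`0 < j ≤ 1`, `τ > 0`, `nstep ≥ 1`). -/
theorem wilson_uniformJitterHMC_certificate :
    ∃ τ₀ : ℝ, 0 < τ₀ ∧ ∀ (nstep : ℕ) (τ j : ℝ), 1 ≤ nstep → 0 < τ → 0 < j → j ≤ 1 → τ * (1 - j) < τ₀ →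
      ∃ m : ℕ, ∃ ε' : ℝ≥0∞, 0 < m ∧ 0 < ε' ∧ ε' ≤ 1 ∧
        ∀ U : GaugeConfig d L (Matrix.specialUnitaryGroup (Fin N) ℂ),
          ε' • wilsonMeasure (d := d) (L := L) (fundamentalRep (Fin N)) (β / N) ≤
            nHit (wilsonJitterHMCL N d L β nstep (uniformJitterLaw τ j)) m U := by
  obtain ⟨τ₀, hτ₀, h⟩ := wilsonJitterHMCL_certificate (N := N) (d := d) (L := L) β
  refine ⟨τ₀, hτ₀, fun nstep τ j hn hτ hj hj1 hshort => ?_⟩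
  obtain ⟨τ₁, τ₂, hτ₁, h12, hτ₂, hη⟩ := uniformJitterLaw_charges_short hτ hj hj1 hshort
  exact h nstep τ₁ τ₂ (uniformJitterLaw τ j) hn hτ₁ h12 hτ₂ hη

variable {mC : Type*} [Fintype mC] [DecidableEq mC]

/-- **THE DOEBLIN CERTIFICATE OF `composite_sweep(f, β, 'hmc', n_or)` WITH `tau_jitter` AS RUN** (`L ≥ 2`; `P` = ANY
schedule of Cabibbo–Marinari over-relaxation hits): same `τ₀`; whenever `τ(1 − j) < τ₀` the composite leaves
`wilsonMeasure (β/N)` invariant and a power of it dominates `ε' · wilsonMeasure (β/N)` from EVERY configuration. -/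
theorem wilson_uniformJitterHMC_orSweep_certificate (hL : 2 ≤ L) :
    ∃ τ₀ : ℝ, 0 < τ₀ ∧ ∀ (nstep : ℕ) (τ j : ℝ) (sched : List (Edge d L × (Fin N ≃ Fin 2 ⊕ mC))),
      1 ≤ nstep → 0 < τ → 0 < j → j ≤ 1 → τ * (1 - j) < τ₀ →
      Invariant (cmORSweep sched ∘ₖ wilsonJitterHMCL N d L β nstep (uniformJitterLaw τ j))
          (wilsonMeasure (d := d) (L := L) (fundamentalRep (Fin N)) (β / N)) ∧
      ∃ m : ℕ, ∃ ε' : ℝ≥0∞, 0 < m ∧ 0 < ε' ∧ ε' ≤ 1 ∧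
        ∀ U : GaugeConfig d L (Matrix.specialUnitaryGroup (Fin N) ℂ),
          ε' • wilsonMeasure (d := d) (L := L) (fundamentalRep (Fin N)) (β / N) ≤
            nHit (cmORSweep sched ∘ₖ wilsonJitterHMCL N d L β nstep (uniformJitterLaw τ j)) m U := by
  obtain ⟨τ₀, hτ₀, h⟩ := wilsonJitterHMCL_orSweep_certificate (N := N) (d := d) (L := L) (mC := mC) β hL
  refine ⟨τ₀, hτ₀, fun nstep τ j sched hn hτ hj hj1 hshort => ?_⟩
  obtain ⟨τ₁, τ₂, hτ₁, h12, hτ₂, hη⟩ := uniformJitterLaw_charges_short hτ hj hj1 hshort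
  exact h nstep τ₁ τ₂ (uniformJitterLaw τ j) sched hn hτ₁ h12 hτ₂ hη

/-- **THE ENGINE'S JITTERED HMC AS RUN, FOLLOWED BY ANY EXACT STEP, CONVERGES TO THE WILSON MEASURE FROM EVERY START**
whenever `τ(1 − j) < τ₀` (`nstep ≥ 1`, `τ > 0`, `0 < j ≤ 1`): `|μ₀ (P ∘ₖ K)ᵗ(A) − wilsonMeasure (β/N)(A)| ≤
(1 − δ)^{⌊t/(mm+1)⌋}` for EVERY initial law, and the Wilson measure is the unique invariant probability law. -/
theorem wilson_uniformJitterHMC_exactStep_uniformlyErgodic :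
    ∃ τ₀ : ℝ, 0 < τ₀ ∧ ∀ (nstep : ℕ) (τ j : ℝ), 1 ≤ nstep → 0 < τ → 0 < j → j ≤ 1 → τ * (1 - j) < τ₀ →
      ∀ (P : Kernel (GaugeConfig d L (Matrix.specialUnitaryGroup (Fin N) ℂ))
          (GaugeConfig d L (Matrix.specialUnitaryGroup (Fin N) ℂ))) [IsMarkovKernel P],
        Invariant P (wilsonMeasure (d := d) (L := L) (fundamentalRep (Fin N)) (β / N)) →
      ∃ mm : ℕ, ∃ δ : ℝ, 0 < δ ∧ δ ≤ 1 ∧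
        (∀ (μ₀ : Measure (GaugeConfig d L (Matrix.specialUnitaryGroup (Fin N) ℂ))) [IsProbabilityMeasure μ₀]
          (t : ℕ) (A : Set (GaugeConfig d L (Matrix.specialUnitaryGroup (Fin N) ℂ))),
          |((fun m : Measure (GaugeConfig d L (Matrix.specialUnitaryGroup (Fin N) ℂ)) =>
                m.bind (P ∘ₖ wilsonJitterHMCL N d L β nstep (uniformJitterLaw τ j)))^[t] μ₀).real A
              - (wilsonMeasure (d := d) (L := L) (fundamentalRep (Fin N)) (β / N)).real A| ≤ (1 - δ) ^ (t / (mm + 1))) ∧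
        ∀ (π' : Measure (GaugeConfig d L (Matrix.specialUnitaryGroup (Fin N) ℂ))) [IsProbabilityMeasure π'],
          Invariant (P ∘ₖ wilsonJitterHMCL N d L β nstep (uniformJitterLaw τ j)) π' →
          π' = wilsonMeasure (d := d) (L := L) (fundamentalRep (Fin N)) (β / N) := by
  obtain ⟨τ₀, hτ₀, h⟩ := wilsonJitterHMCL_exactStep_uniformlyErgodic (N := N) (d := d) (L := L) β
  refine ⟨τ₀, hτ₀, fun nstep τ j hn hτ hj hj1 hshort P _ hP => ?_⟩
  obtain ⟨τ₁, τ₂, hτ₁, h12, hτ₂, hη⟩ := uniformJitterLaw_charges_short hτ hj hj1 hshort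
  exact h nstep τ₁ τ₂ (uniformJitterLaw τ j) hn hτ₁ h12 hτ₂ hη P hP

/-- **`composite_sweep(f, β, 'hmc', n_or)` WITH `tau_jitter` AS RUN CONVERGES TO THE WILSON MEASURE FROM EVERY START**
(`L ≥ 2`, any schedule of Cabibbo–Marinari OR hits) whenever `τ(1 − j) < τ₀`; uniqueness of the invariant law. -/
theorem wilson_uniformJitterHMC_orSweep_uniformlyErgodic (hL : 2 ≤ L) :
    ∃ τ₀ : ℝ, 0 < τ₀ ∧ ∀ (nstep : ℕ) (τ j : ℝ) (sched : List (Edge d L × (Fin N ≃ Fin 2 ⊕ mC))),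
      1 ≤ nstep → 0 < τ → 0 < j → j ≤ 1 → τ * (1 - j) < τ₀ →
      ∃ mm : ℕ, ∃ δ : ℝ, 0 < δ ∧ δ ≤ 1 ∧
        (∀ (μ₀ : Measure (GaugeConfig d L (Matrix.specialUnitaryGroup (Fin N) ℂ))) [IsProbabilityMeasure μ₀]
          (t : ℕ) (A : Set (GaugeConfig d L (Matrix.specialUnitaryGroup (Fin N) ℂ))),
          |((fun μ' : Measure (GaugeConfig d L (Matrix.specialUnitaryGroup (Fin N) ℂ)) =>
                μ'.bind (cmORSweep sched ∘ₖ wilsonJitterHMCL N d L β nstep (uniformJitterLaw τ j)))^[t] μ₀).real A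
              - (wilsonMeasure (d := d) (L := L) (fundamentalRep (Fin N)) (β / N)).real A| ≤ (1 - δ) ^ (t / (mm + 1))) ∧
        ∀ (π' : Measure (GaugeConfig d L (Matrix.specialUnitaryGroup (Fin N) ℂ))) [IsProbabilityMeasure π'],
          Invariant (cmORSweep sched ∘ₖ wilsonJitterHMCL N d L β nstep (uniformJitterLaw τ j)) π' →
          π' = wilsonMeasure (d := d) (L := L) (fundamentalRep (Fin N)) (β / N) := by
  obtain ⟨τ₀, hτ₀, h⟩ := wilsonJitterHMCL_orSweep_uniformlyErgodic (N := N) (d := d) (L := L) (mC := mC) β hL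
  refine ⟨τ₀, hτ₀, fun nstep τ j sched hn hτ hj hj1 hshort => ?_⟩
  obtain ⟨τ₁, τ₂, hτ₁, h12, hτ₂, hη⟩ := uniformJitterLaw_charges_short hτ hj hj1 hshort
  exact h nstep τ₁ τ₂ (uniformJitterLaw τ j) sched hn hτ₁ h12 hτ₂ hη

/-! ## §3 Full jitter `j = 1`: every production length -/

/-- **WITH `tau_jitter = 1` THE ENGINE'S `'hmc' + n_or × 'or'` CONVERGES TO THE WILSON MEASURE FROM EVERY START AT
EVERY PRODUCTION LENGTH `τ > 0` AND EVERY `nstep ≥ 1`** (`L ≥ 2`, any OR schedule); uniqueness of the invariant law.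
No smallness is asked of `τ`: the drawn length is uniform on `[0, 2τ]` and so charges `(0, τ₀]`. -/
theorem wilson_fullJitterHMC_orSweep_uniformlyErgodic (hL : 2 ≤ L) (nstep : ℕ) (hn : 1 ≤ nstep) {τ : ℝ} (hτ : 0 < τ)
    (sched : List (Edge d L × (Fin N ≃ Fin 2 ⊕ mC))) :
    ∃ mm : ℕ, ∃ δ : ℝ, 0 < δ ∧ δ ≤ 1 ∧
      (∀ (μ₀ : Measure (GaugeConfig d L (Matrix.specialUnitaryGroup (Fin N) ℂ))) [IsProbabilityMeasure μ₀]
        (t : ℕ) (A : Set (GaugeConfig d L (Matrix.specialUnitaryGroup (Fin N) ℂ))),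
        |((fun μ' : Measure (GaugeConfig d L (Matrix.specialUnitaryGroup (Fin N) ℂ)) =>
              μ'.bind (cmORSweep sched ∘ₖ wilsonJitterHMCL N d L β nstep (uniformJitterLaw τ 1)))^[t] μ₀).real A
            - (wilsonMeasure (d := d) (L := L) (fundamentalRep (Fin N)) (β / N)).real A| ≤ (1 - δ) ^ (t / (mm + 1))) ∧
      ∀ (π' : Measure (GaugeConfig d L (Matrix.specialUnitaryGroup (Fin N) ℂ))) [IsProbabilityMeasure π'],
        Invariant (cmORSweep sched ∘ₖ wilsonJitterHMCL N d L β nstep (uniformJitterLaw τ 1)) π' →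
        π' = wilsonMeasure (d := d) (L := L) (fundamentalRep (Fin N)) (β / N) := by
  obtain ⟨τ₀, hτ₀, h⟩ := wilson_uniformJitterHMC_orSweep_uniformlyErgodic (N := N) (d := d) (L := L) (mC := mC) β hL
  exact h nstep τ 1 sched hn hτ one_pos le_rfl (by simpa using hτ₀)

end Engine

end Summit.Ventures.LatticeQCDFlow.Exactness
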